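import Mathlib
import HarnessLib

/-!
# Transversal last rows near a full-rank `n × (n + 1)` real matrix

Helper for the Jacquet–Shalika boundary theorem (item stmt-Langlands-13622, line Sketch): in
Jacquet's Godement recursion for the archimedean Rankin–Selberg integrals the top kernel
`Φ₀(g) = Φ[(first n rows of g)] · Φ₁[last row of g]` has to be compactly supported INSIDE
`GL_{n+1}(ℝ)`.  The linear-algebra input is `exists_transversal_lastRow`: near a full-rank
`n × (n + 1)` matrix `A` there is a neighbourhood `V` of `A` and a non-empty open set `U` of last
rows such that appending any `u ∈ U` to any `B ∈ V` gives an invertible `(n + 1) × (n + 1)`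
matrix.

Proof: the `n` rows of `A` are linearly independent (`rank A = n`), so they extend by some `u₀` to
a basis of `ℝ^{n+1}` (`exists_linearIndependent_snoc_of_lt_finrank`); hence
`det (Fin.snoc A u₀) ≠ 0`; the determinant of `Fin.snoc B u` is continuous in `(B, u)`, so it is
non-zero on a product neighbourhood `V ×ˢ U` of `(A, u₀)`.
-/

noncomputable section

-- `Summit.Langlands.Langlands.…` (summit = sub-problem name, D-0017 layout) trips `dupNamespace`
set_option linter.dupNamespace false

open Filter Topology

namespace Summit.Langlands.Langlands.Theorems

/-- The map `(B, u) ↦ Matrix.of (Fin.snoc B u)` (append `u` as the last row of `B`) is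
continuous. -/
private theorem continuous_of_snoc (n : ℕ) :
    Continuous fun p : Matrix (Fin n) (Fin (n + 1)) ℝ × (Fin (n + 1) → ℝ) =>
      (Matrix.of (Fin.snoc p.1 p.2) : Matrix (Fin (n + 1)) (Fin (n + 1)) ℝ) := by
  refine continuous_matrix fun i j => ?_
  simp only [Matrix.of_apply]
  refine Fin.lastCases ?_ (fun i => ?_) i
  · simp only [Fin.snoc_last]
    exact (continuous_apply j).comp continuous_snd
  · simp only [Fin.snoc_castSucc]
    exact continuous_fst.matrix_elem i j

/-- Near a full-rank `n × (n + 1)` real matrix `A` there are a neighbourhood `V` of `A` and a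
non-empty open set `U ⊆ ℝ^{n+1}` of "last rows" such that for every `B ∈ V` and every `u ∈ U`
the square matrix obtained by appending `u` to `B` as its last row is invertible. -/
theorem exists_transversal_lastRow {n : ℕ} (A : Matrix (Fin n) (Fin (n + 1)) ℝ)
    (hA : A.rank = n) :
    ∃ V ∈ 𝓝 A, ∃ U : Set (Fin (n + 1) → ℝ), IsOpen U ∧ U.Nonempty ∧
      ∀ B ∈ V, ∀ u ∈ U, (Matrix.of (Fin.snoc B u) : Matrix (Fin (n + 1)) (Fin (n + 1)) ℝ).det ≠ 0 := by
  -- the rows of `A` are linearly independent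
  have hli : LinearIndependent ℝ A.row := by
    rw [linearIndependent_iff_card_eq_finrank_span, Fintype.card_fin, Set.finrank,
      ← Matrix.rank_eq_finrank_span_row, hA]
  -- extend them by a last row `u₀` to `n + 1` linearly independent vectors
  obtain ⟨u₀, hu₀⟩ := exists_linearIndependent_snoc_of_lt_finrank hli
    (by rw [Module.finrank_fin_fun]; exact Nat.lt_succ_self n)
  have hdet : (Matrix.of (Fin.snoc A u₀) : Matrix (Fin (n + 1)) (Fin (n + 1)) ℝ).det ≠ 0 := by
    have h : IsUnit (Matrix.of (Fin.snoc A u₀) : Matrix (Fin (n + 1)) (Fin (n + 1)) ℝ) :=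
      Matrix.linearIndependent_rows_iff_isUnit.mp hu₀
    rwa [Matrix.isUnit_iff_isUnit_det, isUnit_iff_ne_zero] at h
  -- `det (Fin.snoc B u)` is continuous in `(B, u)`, hence non-zero near `(A, u₀)`
  have hopen : IsOpen {p : Matrix (Fin n) (Fin (n + 1)) ℝ × (Fin (n + 1) → ℝ) |
      (Matrix.of (Fin.snoc p.1 p.2) : Matrix (Fin (n + 1)) (Fin (n + 1)) ℝ).det ≠ 0} :=
    isOpen_ne.preimage (continuous_of_snoc n).matrix_det
  obtain ⟨V, U, hV, hAV, hU, huU, hsub⟩ := mem_nhds_prod_iff'.mp (hopen.mem_nhds hdet)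
  exact ⟨V, hV.mem_nhds hAV, U, hU, ⟨u₀, huU⟩, fun B hB u hu => hsub (Set.mk_mem_prod hB hu)⟩

end Summit.Langlands.Langlands.Theorems
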